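import Mathlib
import Summits.NavierStokesRegularity.NavierStokesRegularity.Theses.TypeILiouville
import Summits.NavierStokesRegularity.NavierStokesRegularity.Theses.TypeTwoEternal
import Summits.NavierStokesRegularity.NavierStokesRegularity.Theorems.TypeILiouvilleTypeIliouvilleLOseenGauge
import Literature.Analysis.FluidPDE.KNSSRemark61
import Literature.Analysis.FluidPDE.SelfSimilarLiouville
import Literature.Analysis.FluidPDE.AncientMildCompactness
import Literature.Analysis.FluidPDE.KNSSRegularityGalileanProofs
import Literature.Analysis.FluidPDE.KNSSOseenMildDecayTools
import Literature.Analysis.FluidPDE.NSBoundedMildSmoothing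
import Literature.Analysis.FluidPDE.KNSSTypeIRateLiouvilleMild

/-!
# (L) «QUIESCENT PAST vs ETERNAL SHADOW» — the α-limit cut of the KNSS Liouville crux `TypeIliouvilleL` (stmt-10661)

decomp-ns lens-2 g16 node (critic row 188 CLEARED modest), banked: with print's class of bounded ancient mild solutions
(KNSS 2009 §4 (i); continuous, bounded, weakly divergence-free, Oseen-mild on `(−∞,0) × ℝ³`) and the QUIESCENT PAST
`∀ ε > 0 ∃ T < 0 ∀ t < T ∀ x y, |x − y| ≤ 1 → ‖v(t,x) − v(t,y)‖ ≤ ε` (spelled inline everywhere; no defs):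

* §0 gauge (inlined tree lemmas, primed; the module `TypeILiouvilleTypeIliouvilleLMildGaugeEquivalence` is unbuilt on
  the farm today): (L) for the duality class ⟺ (L) for print's class;
* §2 the node: (L) ⟸ EL ∧ L_Q ∧ SX (`liouvilleL_of`), (L) ⟹ L_Q, (L) ⟹ EL, and SX ⟹ ((L) ⟺ EL ∧ L_Q)
  (`liouvilleL_iff_eternal_and_quiescent`) — EL = `Theses.TypeTwoEternal.EternalLiouville` (stmt-18161) BY NAME;
* §4 the PROVED rungs of the support SX: S1 `printClass_translate` (print's class is invariant under backward
  space-time translation), S2 `ancientShadow_exists` (KNSS Lemma 6.1 on the translates: an ancient print-class limit).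
  S3 (windows + diagonal + non-constancy of the limit slice) and S4 (class conversion) are the prover target of the line
  `Cruxes/TypeIliouvilleL/Lines/quiescent-shadow.lean`.

Sources: KNSS 2009 (arXiv:0709.3599) §1, Prop. 4.1, Lemma 6.1 [KochNadirashviliSereginSverak2009]; Seregin 2014 lecture
notes §6.4 [corpus:book:seregin2014-lecture-notes-regularity-theory-navier-stokes-equations p.109–121];
Poláčik–Quittner–Souplet 2007; lens file HOME/decomp-ns-lens-2/QuiescentShadow.lean (sha256 1c8620c4…).
-/

set_option linter.dupNamespace false

noncomputable section

open MeasureTheory Filter Set Function Metric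
open scoped Topology
open Literature.Analysis Literature.Analysis.FluidPDE Literature.Analysis.UnboundedOperators
open Summit.NavierStokesRegularity.NavierStokesRegularity

namespace Summit.NavierStokesRegularity.NavierStokesRegularity.Theorems.TypeILiouvilleQuiescentShadow

/-! ## §0 The crux's class and print's class carry the same Liouville statement -/

/-- (L) for the duality-form class ⟹ (L) for print's class (= tree `oseenMild_const_of_TypeIliouvilleL`). -/
theorem oseenMild_const_of_liouvilleL'
    (hL : Theses.TypeILiouville.TypeIliouvilleL)
    (v : ℝ → EuclideanSpace ℝ (Fin 3) → EuclideanSpace ℝ (Fin 3))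
    (hcont : ContinuousOn (uncurry v) (Iio 0 ×ˢ univ))
    (hbdd : ∃ K : ℝ, ∀ t < 0, ∀ x, ‖v t x‖ ≤ K)
    (hdiv : ∀ t < 0, Literature.Analysis.FluidPDE.IsWeaklyDivFree (v t))
    (hmild : ∀ s t : ℝ, s < t → t < 0 → ∀ x,
      v t x = Literature.Analysis.UnboundedOperators.heatExtension (v s) (t - s) x -
        Literature.Analysis.FluidPDE.oseenDuhamel 1 s v v t x) :
    ∃ b : EuclideanSpace ℝ (Fin 3), ∀ t < 0, ∀ x, v t x = b := by
  classical
  have hmild1 : ∀ s t : ℝ, s < t → t < 0 → ∀ x,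
      v t x = Literature.Analysis.UnboundedOperators.heatExtension (v s) (1 * (t - s)) x -
        Literature.Analysis.FluidPDE.oseenDuhamel 1 s v v t x := by
    intro s t hst ht x
    rw [one_mul]
    exact hmild s t hst ht x
  have hv : Literature.Analysis.FluidPDE.IsBoundedAncientMildSolution 1 v :=
    Literature.Analysis.FluidPDE.isBoundedAncientMildSolution_of_oseen one_pos hcont hbdd hdiv hmild1
  have hvc : ∀ t < 0, Continuous (v t) := fun t ht =>
    hcont.comp_continuous (Continuous.prodMk_right t) fun x => mem_prod.2 ⟨ht, mem_univ x⟩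
  have hmeas : ∀ t < 0, AEStronglyMeasurable (v t) volume := fun t ht =>
    (hvc t ht).aestronglyMeasurable
  have hslice : ∀ t < 0, ∃ b : EuclideanSpace ℝ (Fin 3), ∀ x, v t x = b := by
    intro t ht
    obtain ⟨b, hb⟩ := hL v hv hmeas t ht
    have : v t = fun _ => b :=
      (Continuous.ae_eq_iff_eq volume (hvc t ht) continuous_const).1 hb
    exact ⟨b, fun x => congrFun this x⟩
  set b : ℝ → EuclideanSpace ℝ (Fin 3) := fun t =>
    if ht : t < 0 then Classical.choose (hslice t ht) else 0 with hb_def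
  have hub : ∀ t < 0, ∀ x, v t x = b t := by
    intro t ht x
    have h := Classical.choose_spec (hslice t ht) x
    simp only [hb_def, dif_pos ht]
    exact h
  have htime : ∀ s t : ℝ, s < 0 → t < 0 → b s = b t :=
    Literature.Analysis.FluidPDE.KNSS2009_remark61 one_pos hub
      fun s t hst ht => Eventually.of_forall fun x => hmild1 s t hst ht x
  refine ⟨b (-1), fun t ht x => ?_⟩
  rw [hub t ht x, htime t (-1) ht (by norm_num)]

/-- (L) for print's class ⟹ (L) for the duality-form class, through the landed Oseen gauge theorem
`oseen_gauge_of_aestronglyMeasurable` (= tree `TypeIliouvilleL_of_oseenMild_const`). -/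
theorem liouvilleL_of_oseenMild_const'
    (hM : ∀ v : ℝ → EuclideanSpace ℝ (Fin 3) → EuclideanSpace ℝ (Fin 3),
      ContinuousOn (uncurry v) (Iio 0 ×ˢ univ) →
      (∃ K : ℝ, ∀ t < 0, ∀ x, ‖v t x‖ ≤ K) →
      (∀ t < 0, Literature.Analysis.FluidPDE.IsWeaklyDivFree (v t)) →
      (∀ s t : ℝ, s < t → t < 0 → ∀ x,
        v t x = Literature.Analysis.UnboundedOperators.heatExtension (v s) (t - s) x -
          Literature.Analysis.FluidPDE.oseenDuhamel 1 s v v t x) →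
      ∃ b : EuclideanSpace ℝ (Fin 3), ∀ t < 0, ∀ x, v t x = b) :
    Theses.TypeILiouville.TypeIliouvilleL := by
  intro u hu hmeas t ht
  obtain ⟨v, A, c, -, hvc, hvK, hvd, hvm, -, hrep⟩ :=
    Theorems.oseen_gauge_of_aestronglyMeasurable u hu hmeas
  obtain ⟨b, hb⟩ := hM v hvc hvK hvd hvm
  refine ⟨b + c t, ?_⟩
  filter_upwards [hrep t ht] with x hx
  rw [hx, hb t ht]
/-! ## §2 The node in kernel: (L) ⟸ EL ∧ L_Q ∧ SX, and exactness -/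

/-- Print-class Liouville from the three pieces: excluded middle on `QuiescentPast v`. -/
theorem oseenLiouville_of (hE : Theses.TypeTwoEternal.EternalLiouville) (hQ : (∀ v : ℝ → EuclideanSpace ℝ (Fin 3) → EuclideanSpace ℝ (Fin 3),
      ContinuousOn (uncurry v) (Iio 0 ×ˢ univ) →
      (∃ K : ℝ, ∀ t < 0, ∀ x, ‖v t x‖ ≤ K) →
      (∀ t < 0, Literature.Analysis.FluidPDE.IsWeaklyDivFree (v t)) →
      (∀ s t : ℝ, s < t → t < 0 → ∀ x,
        v t x = Literature.Analysis.UnboundedOperators.heatExtension (v s) (t - s) x -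
          Literature.Analysis.FluidPDE.oseenDuhamel 1 s v v t x) →
      (∀ ε : ℝ, 0 < ε → ∃ T : ℝ, T < 0 ∧ ∀ t < T, ∀ x y : EuclideanSpace ℝ (Fin 3),
        dist x y ≤ 1 → ‖v t x - v t y‖ ≤ ε) →
      ∃ b : EuclideanSpace ℝ (Fin 3), ∀ t < 0, ∀ x, v t x = b))
    (hX : (∀ v : ℝ → EuclideanSpace ℝ (Fin 3) → EuclideanSpace ℝ (Fin 3),
      ContinuousOn (uncurry v) (Iio 0 ×ˢ univ) →
      (∃ K : ℝ, ∀ t < 0, ∀ x, ‖v t x‖ ≤ K) →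
      (∀ t < 0, Literature.Analysis.FluidPDE.IsWeaklyDivFree (v t)) →
      (∀ s t : ℝ, s < t → t < 0 → ∀ x,
        v t x = Literature.Analysis.UnboundedOperators.heatExtension (v s) (t - s) x -
          Literature.Analysis.FluidPDE.oseenDuhamel 1 s v v t x) →
      ¬ (∀ ε : ℝ, 0 < ε → ∃ T : ℝ, T < 0 ∧ ∀ t < T, ∀ x y : EuclideanSpace ℝ (Fin 3),
        dist x y ≤ 1 → ‖v t x - v t y‖ ≤ ε) →
      ∃ V : ℝ → EuclideanSpace ℝ (Fin 3) → EuclideanSpace ℝ (Fin 3),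
        (∀ τ : ℝ, Literature.Analysis.FluidPDE.IsAncientMildSolution 1 (fun t => V (t + τ))) ∧
        (∃ C : ℝ, ∀ t x, ‖V t x‖ ≤ C) ∧
        (∀ t, MeasureTheory.AEStronglyMeasurable (V t) MeasureTheory.volume) ∧
        ContDiff ℝ (⊤ : ℕ∞) (Function.uncurry V) ∧
        ∃ (t : ℝ) (x y : EuclideanSpace ℝ (Fin 3)), V t x ≠ V t y)) :
    ∀ v : ℝ → EuclideanSpace ℝ (Fin 3) → EuclideanSpace ℝ (Fin 3),
      ContinuousOn (uncurry v) (Iio 0 ×ˢ univ) →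
      (∃ K : ℝ, ∀ t < 0, ∀ x, ‖v t x‖ ≤ K) →
      (∀ t < 0, Literature.Analysis.FluidPDE.IsWeaklyDivFree (v t)) →
      (∀ s t : ℝ, s < t → t < 0 → ∀ x,
        v t x = Literature.Analysis.UnboundedOperators.heatExtension (v s) (t - s) x -
          Literature.Analysis.FluidPDE.oseenDuhamel 1 s v v t x) →
      ∃ b : EuclideanSpace ℝ (Fin 3), ∀ t < 0, ∀ x, v t x = b := by
  intro v hc hK hd hm
  by_cases hq : (∀ ε : ℝ, 0 < ε → ∃ T : ℝ, T < 0 ∧ ∀ t < T, ∀ x y : EuclideanSpace ℝ (Fin 3), dist x y ≤ 1 → ‖v t x - v t y‖ ≤ ε)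
  · exact hQ v hc hK hd hm hq
  · obtain ⟨V, h1, h2, h3, h4, t, x, y, hne⟩ := hX v hc hK hd hm hq
    obtain ⟨b, hb⟩ := hE V h1 h2 h3 h4 t
    exact absurd ((hb x).trans (hb y).symm) hne

/-- **(L) ⟸ EL ∧ L_Q ∧ SX** — the node, concluding the crux `TypeIliouvilleL` (stmt-10661) BY NAME
(through the landed Oseen gauge theorem, §0). -/
theorem liouvilleL_of (hE : Theses.TypeTwoEternal.EternalLiouville) (hQ : (∀ v : ℝ → EuclideanSpace ℝ (Fin 3) → EuclideanSpace ℝ (Fin 3),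
      ContinuousOn (uncurry v) (Iio 0 ×ˢ univ) →
      (∃ K : ℝ, ∀ t < 0, ∀ x, ‖v t x‖ ≤ K) →
      (∀ t < 0, Literature.Analysis.FluidPDE.IsWeaklyDivFree (v t)) →
      (∀ s t : ℝ, s < t → t < 0 → ∀ x,
        v t x = Literature.Analysis.UnboundedOperators.heatExtension (v s) (t - s) x -
          Literature.Analysis.FluidPDE.oseenDuhamel 1 s v v t x) →
      (∀ ε : ℝ, 0 < ε → ∃ T : ℝ, T < 0 ∧ ∀ t < T, ∀ x y : EuclideanSpace ℝ (Fin 3),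
        dist x y ≤ 1 → ‖v t x - v t y‖ ≤ ε) →
      ∃ b : EuclideanSpace ℝ (Fin 3), ∀ t < 0, ∀ x, v t x = b))
    (hX : (∀ v : ℝ → EuclideanSpace ℝ (Fin 3) → EuclideanSpace ℝ (Fin 3),
      ContinuousOn (uncurry v) (Iio 0 ×ˢ univ) →
      (∃ K : ℝ, ∀ t < 0, ∀ x, ‖v t x‖ ≤ K) →
      (∀ t < 0, Literature.Analysis.FluidPDE.IsWeaklyDivFree (v t)) →
      (∀ s t : ℝ, s < t → t < 0 → ∀ x,
        v t x = Literature.Analysis.UnboundedOperators.heatExtension (v s) (t - s) x -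
          Literature.Analysis.FluidPDE.oseenDuhamel 1 s v v t x) →
      ¬ (∀ ε : ℝ, 0 < ε → ∃ T : ℝ, T < 0 ∧ ∀ t < T, ∀ x y : EuclideanSpace ℝ (Fin 3),
        dist x y ≤ 1 → ‖v t x - v t y‖ ≤ ε) →
      ∃ V : ℝ → EuclideanSpace ℝ (Fin 3) → EuclideanSpace ℝ (Fin 3),
        (∀ τ : ℝ, Literature.Analysis.FluidPDE.IsAncientMildSolution 1 (fun t => V (t + τ))) ∧
        (∃ C : ℝ, ∀ t x, ‖V t x‖ ≤ C) ∧
        (∀ t, MeasureTheory.AEStronglyMeasurable (V t) MeasureTheory.volume) ∧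
        ContDiff ℝ (⊤ : ℕ∞) (Function.uncurry V) ∧
        ∃ (t : ℝ) (x y : EuclideanSpace ℝ (Fin 3)), V t x ≠ V t y)) : Theses.TypeILiouville.TypeIliouvilleL :=
  liouvilleL_of_oseenMild_const' (oseenLiouville_of hE hQ hX)

/-- Exactness, first half: **(L) ⟹ L_Q** (L_Q is (L) restricted to a sub-class). -/
theorem quiescentLiouville_of_liouvilleL (hL : Theses.TypeILiouville.TypeIliouvilleL) :
    (∀ v : ℝ → EuclideanSpace ℝ (Fin 3) → EuclideanSpace ℝ (Fin 3),
      ContinuousOn (uncurry v) (Iio 0 ×ˢ univ) →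
      (∃ K : ℝ, ∀ t < 0, ∀ x, ‖v t x‖ ≤ K) →
      (∀ t < 0, Literature.Analysis.FluidPDE.IsWeaklyDivFree (v t)) →
      (∀ s t : ℝ, s < t → t < 0 → ∀ x,
        v t x = Literature.Analysis.UnboundedOperators.heatExtension (v s) (t - s) x -
          Literature.Analysis.FluidPDE.oseenDuhamel 1 s v v t x) →
      (∀ ε : ℝ, 0 < ε → ∃ T : ℝ, T < 0 ∧ ∀ t < T, ∀ x y : EuclideanSpace ℝ (Fin 3),
        dist x y ≤ 1 → ‖v t x - v t y‖ ≤ ε) →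
      ∃ b : EuclideanSpace ℝ (Fin 3), ∀ t < 0, ∀ x, v t x = b) :=
  fun v hc hK hd hm _ => oseenMild_const_of_liouvilleL' hL v hc hK hd hm

/-- Exactness, second half: **(L) ⟹ EL** (translate the slice to time `−1`, apply (L), upgrade
a.e.-constancy to constancy by continuity; = lens-4 g3's kernel edge, re-proved here so the file
is self-contained). -/
theorem eternalLiouville_of_liouvilleL (hL : Theses.TypeILiouville.TypeIliouvilleL) :
    Theses.TypeTwoEternal.EternalLiouville := by
  intro v hanc hbd hmeas hsm t
  obtain ⟨C, hC⟩ := hbd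
  have hw : IsBoundedAncientMildSolution 1 (fun s => v (s + (t + 1))) :=
    ⟨hanc (t + 1), ⟨C, fun s _ x => hC _ _⟩⟩
  obtain ⟨b, hb⟩ :=
    hL (fun s => v (s + (t + 1))) hw (fun s _ => hmeas _) (-1) (by norm_num)
  have ht : (-1 : ℝ) + (t + 1) = t := by ring
  have hae : v t =ᵐ[volume] fun _ => b := by simpa only [ht] using hb
  have hcont : Continuous (v t) :=
    hsm.continuous.comp (continuous_const.prodMk continuous_id)
  have heq : v t = fun _ => b := (Continuous.ae_eq_iff_eq volume hcont continuous_const).1 hae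
  exact ⟨b, fun x => congrFun heq x⟩

/-- **EXACTNESS (door-order edge, new)**: given the theorem-grade support SX, the KNSS conjecture
(L) is EQUIVALENT to ETERNAL LIOUVILLE ∧ QUIESCENT LIOUVILLE — the gap between eternal and ancient
Liouville is exactly the quiescent-past class. -/
theorem liouvilleL_iff_eternal_and_quiescent (hX : (∀ v : ℝ → EuclideanSpace ℝ (Fin 3) → EuclideanSpace ℝ (Fin 3),
      ContinuousOn (uncurry v) (Iio 0 ×ˢ univ) →
      (∃ K : ℝ, ∀ t < 0, ∀ x, ‖v t x‖ ≤ K) →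
      (∀ t < 0, Literature.Analysis.FluidPDE.IsWeaklyDivFree (v t)) →
      (∀ s t : ℝ, s < t → t < 0 → ∀ x,
        v t x = Literature.Analysis.UnboundedOperators.heatExtension (v s) (t - s) x -
          Literature.Analysis.FluidPDE.oseenDuhamel 1 s v v t x) →
      ¬ (∀ ε : ℝ, 0 < ε → ∃ T : ℝ, T < 0 ∧ ∀ t < T, ∀ x y : EuclideanSpace ℝ (Fin 3),
        dist x y ≤ 1 → ‖v t x - v t y‖ ≤ ε) →
      ∃ V : ℝ → EuclideanSpace ℝ (Fin 3) → EuclideanSpace ℝ (Fin 3),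
        (∀ τ : ℝ, Literature.Analysis.FluidPDE.IsAncientMildSolution 1 (fun t => V (t + τ))) ∧
        (∃ C : ℝ, ∀ t x, ‖V t x‖ ≤ C) ∧
        (∀ t, MeasureTheory.AEStronglyMeasurable (V t) MeasureTheory.volume) ∧
        ContDiff ℝ (⊤ : ℕ∞) (Function.uncurry V) ∧
        ∃ (t : ℝ) (x y : EuclideanSpace ℝ (Fin 3)), V t x ≠ V t y)) :
    Theses.TypeILiouville.TypeIliouvilleL ↔
      (Theses.TypeTwoEternal.EternalLiouville ∧
      (∀ v : ℝ → EuclideanSpace ℝ (Fin 3) → EuclideanSpace ℝ (Fin 3),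
      ContinuousOn (uncurry v) (Iio 0 ×ˢ univ) →
      (∃ K : ℝ, ∀ t < 0, ∀ x, ‖v t x‖ ≤ K) →
      (∀ t < 0, Literature.Analysis.FluidPDE.IsWeaklyDivFree (v t)) →
      (∀ s t : ℝ, s < t → t < 0 → ∀ x,
        v t x = Literature.Analysis.UnboundedOperators.heatExtension (v s) (t - s) x -
          Literature.Analysis.FluidPDE.oseenDuhamel 1 s v v t x) →
      (∀ ε : ℝ, 0 < ε → ∃ T : ℝ, T < 0 ∧ ∀ t < T, ∀ x y : EuclideanSpace ℝ (Fin 3),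
        dist x y ≤ 1 → ‖v t x - v t y‖ ≤ ε) →
      ∃ b : EuclideanSpace ℝ (Fin 3), ∀ t < 0, ∀ x, v t x = b)) :=
  ⟨fun hL => ⟨eternalLiouville_of_liouvilleL hL, quiescentLiouville_of_liouvilleL hL⟩,
    fun h => liouvilleL_of h.1 h.2 hX⟩

/-! ## §4 Rungs of the support SX (PROVED): translates stay in print's class; ancient shadows exist -/

/-- **S1 — print's class is invariant under backward space-time translation**: for `t₀ ≤ 0` and any
`x₀`, `w(t,x) := v(t + t₀, x + x₀)` is again continuous and bounded (same bound) on `(−∞,0) × ℝ³`,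
weakly divergence free, and solves the Oseen integral equation (tree: `heatExtension_comp_add_right_apply`,
`oseenDuhamel_comp_add_right`, `oseenDuhamel_translate`, `IsWeaklyDivFree.comp_add_right'`). -/
theorem printClass_translate {v : ℝ → EuclideanSpace ℝ (Fin 3) → EuclideanSpace ℝ (Fin 3)} {K : ℝ}
    (hc : ContinuousOn (uncurry v) (Iio 0 ×ˢ univ))
    (hK : ∀ t < 0, ∀ x, ‖v t x‖ ≤ K)
    (hd : ∀ t < 0, Literature.Analysis.FluidPDE.IsWeaklyDivFree (v t))
    (hm : ∀ s t : ℝ, s < t → t < 0 → ∀ x,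
      v t x = Literature.Analysis.UnboundedOperators.heatExtension (v s) (t - s) x -
        Literature.Analysis.FluidPDE.oseenDuhamel 1 s v v t x)
    {t₀ : ℝ} (ht₀ : t₀ ≤ 0) (x₀ : EuclideanSpace ℝ (Fin 3)) :
    ContinuousOn (uncurry (fun t x => v (t + t₀) (x + x₀))) (Iio 0 ×ˢ univ) ∧
    (∀ t < 0, ∀ x, ‖(fun t x => v (t + t₀) (x + x₀)) t x‖ ≤ K) ∧
    (∀ t < 0, Literature.Analysis.FluidPDE.IsWeaklyDivFree ((fun t x => v (t + t₀) (x + x₀)) t)) ∧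
    (∀ s t : ℝ, s < t → t < 0 → ∀ x,
      (fun t x => v (t + t₀) (x + x₀)) t x =
        Literature.Analysis.UnboundedOperators.heatExtension ((fun t x => v (t + t₀) (x + x₀)) s) (t - s) x -
        Literature.Analysis.FluidPDE.oseenDuhamel 1 s (fun t x => v (t + t₀) (x + x₀))
          (fun t x => v (t + t₀) (x + x₀)) t x) := by
  refine ⟨?_, ?_, ?_, ?_⟩
  · -- continuity: compose with the affine map `(t, x) ↦ (t + t₀, x + x₀)`, which maps the slab into itself
    have hφ : Continuous (fun p : ℝ × EuclideanSpace ℝ (Fin 3) => (p.1 + t₀, p.2 + x₀)) := by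
      fun_prop
    have hmaps : MapsTo (fun p : ℝ × EuclideanSpace ℝ (Fin 3) => (p.1 + t₀, p.2 + x₀))
        (Iio 0 ×ˢ univ) (Iio 0 ×ˢ univ) := by
      intro p hp
      simp only [mem_prod, mem_Iio, mem_univ, and_true] at hp ⊢
      linarith
    have h := hc.comp hφ.continuousOn hmaps
    refine h.congr (fun p _ => ?_)
    rfl
  · intro t ht x
    exact hK (t + t₀) (by linarith) (x + x₀)
  · intro t ht
    exact (hd (t + t₀) (by linarith)).comp_add_right' x₀
  · intro s t hst ht0 x
    have h1 : Literature.Analysis.FluidPDE.oseenDuhamel 1 s (fun t x => v (t + t₀) (x + x₀))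
          (fun t x => v (t + t₀) (x + x₀)) t x =
        Literature.Analysis.FluidPDE.oseenDuhamel 1 s (fun τ => v (τ + t₀)) (fun τ => v (τ + t₀)) t
          (x + x₀) :=
      oseenDuhamel_comp_add_right 1 s (fun τ => v (τ + t₀)) (fun τ => v (τ + t₀)) x₀ t x
    have h2 : Literature.Analysis.FluidPDE.oseenDuhamel 1 s (fun τ => v (τ + t₀)) (fun τ => v (τ + t₀)) t
          (x + x₀) =
        Literature.Analysis.FluidPDE.oseenDuhamel 1 (s + t₀) v v (t + t₀) (x + x₀) :=
      oseenDuhamel_translate 1 s t₀ v v t (x + x₀)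
    have h3 : Literature.Analysis.UnboundedOperators.heatExtension
          ((fun t x => v (t + t₀) (x + x₀)) s) (t - s) x =
        Literature.Analysis.UnboundedOperators.heatExtension (v (s + t₀)) (t - s) (x + x₀) :=
      heatExtension_comp_add_right_apply (v (s + t₀)) x₀ (t - s) x
    have h4 := hm (s + t₀) (t + t₀) (by linarith) (by linarith) (x + x₀)
    have h5 : t + t₀ - (s + t₀) = t - s := by ring
    rw [h5] at h4
    show v (t + t₀) (x + x₀) = _
    rw [h3, h1, h2]
    exact h4

/-- **S2 — ANCIENT SHADOWS EXIST** (KNSS 2009 Lemma 6.1 on the translates, tree engine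
`KNSS2009_lemma61_oseenMild`): for every member `v` of print's class and all sequences `t_k ≤ 0`,
`x_k`, a subsequence of the translates `v(· + t_k, · + x_k)` converges pointwise on `(−∞,0) × ℝ³`
(indeed locally uniformly) to a member `W` of print's class with the same bound. What SX still needs
beyond this (S3–S4 of its docstring): the windows `(−∞, m)` with a diagonal, the non-constancy of the
limit slice from `¬ QuiescentPast`, and the class conversion. -/
theorem ancientShadow_exists {v : ℝ → EuclideanSpace ℝ (Fin 3) → EuclideanSpace ℝ (Fin 3)} {K : ℝ}
    (hc : ContinuousOn (uncurry v) (Iio 0 ×ˢ univ))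
    (hK : ∀ t < 0, ∀ x, ‖v t x‖ ≤ K)
    (hd : ∀ t < 0, Literature.Analysis.FluidPDE.IsWeaklyDivFree (v t))
    (hm : ∀ s t : ℝ, s < t → t < 0 → ∀ x,
      v t x = Literature.Analysis.UnboundedOperators.heatExtension (v s) (t - s) x -
        Literature.Analysis.FluidPDE.oseenDuhamel 1 s v v t x)
    (tk : ℕ → ℝ) (htk : ∀ k, tk k ≤ 0) (xk : ℕ → EuclideanSpace ℝ (Fin 3)) :
    ∃ (φ : ℕ → ℕ) (W : ℝ → EuclideanSpace ℝ (Fin 3) → EuclideanSpace ℝ (Fin 3)), StrictMono φ ∧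
      ContinuousOn (uncurry W) (Iio 0 ×ˢ univ) ∧
      (∀ t < 0, Literature.Analysis.FluidPDE.IsWeaklyDivFree (W t)) ∧
      (∀ t < 0, ∀ x, ‖W t x‖ ≤ K) ∧
      (∀ s t : ℝ, s < t → t < 0 → ∀ x,
        W t x = Literature.Analysis.UnboundedOperators.heatExtension (W s) (t - s) x -
          Literature.Analysis.FluidPDE.oseenDuhamel 1 s W W t x) ∧
      (∀ t < 0, ∀ x, Tendsto (fun j => v (t + tk (φ j)) (x + xk (φ j))) atTop (𝓝 (W t x))) := by
  have H := fun k => printClass_translate hc hK hd hm (htk k) (xk k)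
  have hAlim : Tendsto (fun k : ℕ => -((k : ℝ) + 1)) atTop atBot :=
    tendsto_neg_atTop_atBot.comp (tendsto_atTop_add_const_right atTop 1 tendsto_natCast_atTop_atTop)
  obtain ⟨φ, W, hφ, hWc, hWd, hWb, hWm, -, hpt, -⟩ :=
    KNSS2009_lemma61_oseenMild (A := fun k : ℕ => -((k : ℝ) + 1))
      (w := fun k t x => v (t + tk k) (x + xk k)) (C := K) hAlim
      (fun k => (H k).1.mono (prod_mono Ioo_subset_Iio_self Subset.rfl))
      (fun k t ht => (H k).2.2.1 t ht.2)
      (fun k s t _ hst ht0 x => (H k).2.2.2 s t hst ht0 x)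
      (fun k τ hτ x => (H k).2.1 τ hτ.2 x)
  exact ⟨φ, W, hφ, hWc, hWd, hWb, hWm, hpt⟩


end Summit.NavierStokesRegularity.NavierStokesRegularity.Theorems.TypeILiouvilleQuiescentShadow

end
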